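import Summits.AnomalousDissipation.AnomalousDissipation.Theorems.SolenoidalFractalHomogenisationLagrangianStepOneLevelSplitDefs
import Literature.Analysis.FluidPDE.LagrangianLatticeCarrier
import HarnessLib

/-!
# K1L_D (stmt-AnomalousDissipation-27980), `stub_Z7_alphaBeta` α-provider (memo L13 §1): the frame READING maps and the CONJUGATE of an
# Eulerian two-parameter family (Summits-side definitions file; review lane; lead-k1l-onelevel-p1 g5)

On a refresh piece starting at the reset `s = j·refresh (m+1)`, the Lagrangian frame of level `m+1` is the window flow `X m · s` of the coarse
partial sum (restarted at `s`).  In CELL time `σ = a(m+1)·(t' − s)`: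
* `frameRead E hR m s σ : V2 →L[ℝ] V2` — `u ↦ u ∘ X m (s + σ/a(m+1)) s`, a linear isometry of `V2 = L²(𝕋³;ℝ³)` (the flow preserves volume,
  `LevelRegular` (F2c); Mathlib `Lp.compMeasurePreservingₗᵢ`);
* `frameReadInv E hR m s σ` — `v ↦ v ∘ X m s (s + σ/a(m+1))` (the inverse flow, `LevelRegular` (F2a,b));
* `conjProp E hR m s U σ₁ σ₂ := frameRead σ₂ ∘ U (s + σ₁/a) (s + σ₂/a) ∘ frameReadInv σ₁` — the frame conjugate of an Eulerian family `U`
  (physical time); `conjProp … Um1` / `conjProp … Um` are the `Ut` / `Tt` of `Z7Glue.FrameConjugacyAt` (typed targets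
  `Cruxes/LagrangianRenormalisationStep/Lines/onelevel_L13_frame.lean`).
Definitions only; nothing proved; AD not proved; rung F-D1.A0.
-/

set_option linter.dupNamespace false  -- the summit-side namespace `Summit.AnomalousDissipation.AnomalousDissipation.…` repeats a component by design (D-0017)

noncomputable section

namespace Summit.AnomalousDissipation.AnomalousDissipation.Theorems.SolenoidalFractalHomogenisation.LagrangianStep.FrameConj

open Literature.Analysis Literature.Analysis.FluidPDE Literature.Analysis.FunctionSpaces
open MeasureTheory
open Literature.Analysis.FluidPDE.LatticeShear (LagrangianLatticeCarrier)

variable {k : ℕ}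

/-- **The READING map of the frame started at `s`, at cell time `σ`**: `u ↦ u ∘ X m (s + σ/a(m+1)) s` as a continuous linear map of `V2`
(a linear isometry: composition with the volume-preserving window flow). -/
def frameRead (E : LagrangianLatticeCarrier k) (hR : E.LevelRegular) (m : ℕ) (s σ : ℝ) : V2 →L[ℝ] V2 :=
  (Lp.compMeasurePreservingₗᵢ ℝ (E.X m (s + σ / E.a (m + 1)) s) (hR.measurePreserving_X m (s + σ / E.a (m + 1)) s)).toContinuousLinearMap

/-- **The inverse reading** at cell time `σ`: `v ↦ v ∘ X m s (s + σ/a(m+1))`. -/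
def frameReadInv (E : LagrangianLatticeCarrier k) (hR : E.LevelRegular) (m : ℕ) (s σ : ℝ) : V2 →L[ℝ] V2 :=
  (Lp.compMeasurePreservingₗᵢ ℝ (E.X m s (s + σ / E.a (m + 1))) (hR.measurePreserving_X m s (s + σ / E.a (m + 1)))).toContinuousLinearMap

/-- **The frame CONJUGATE of an Eulerian two-parameter family** `U` (physical time), in cell time:
`conjProp σ₁ σ₂ = frameRead σ₂ ∘ U (s + σ₁/a) (s + σ₂/a) ∘ frameReadInv σ₁`. -/
def conjProp (E : LagrangianLatticeCarrier k) (hR : E.LevelRegular) (m : ℕ) (s : ℝ) (U : ℝ → ℝ → (V2 →L[ℝ] V2)) :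
    ℝ → ℝ → (V2 →L[ℝ] V2) :=
  fun σ₁ σ₂ => (frameRead E hR m s σ₂).comp ((U (s + σ₁ / E.a (m + 1)) (s + σ₂ / E.a (m + 1))).comp (frameReadInv E hR m s σ₁))

end Summit.AnomalousDissipation.AnomalousDissipation.Theorems.SolenoidalFractalHomogenisation.LagrangianStep.FrameConj

end
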